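import Literature.Barriers.CriticalPhenomena.PlaquetteWalkHoleRootThinBoxCells
import HarnessLib

/-!
# Barrier catalogue (SAWScalingLimit): THIN-BOX LAW L AT THE SIDE WALLS — a hole one row above the bottom wall AND two
columns from the west wall, or with its root plaquette two columns from the east wall

Assembly leaf (no new mechanism, no new definition) of `PlaquetteWalkHoleRootThinBoxCells` (thin-side tools with abstract
witnesses, `thinBox_hyps`, the height-four box) and, through it, `PlaquetteWalkHoleRootWallPocket` (a western pocket on the
wall empties the over route), `PlaquetteWalkHoleRootWestCorridor` / `PlaquetteWalkHoleRootCorridor` + `PlaquetteWalkHoleRootLawLBoxes`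
(the corner corridors of a box), `PlaquetteWalkHoleRootThinSide` (the over blocks). Setting: the `m × n` box, hole `h` with
`h.2 = 1` (ONE row above the bottom wall: the under route is EMPTY), root plaquette `w = (h.1 + 1, 1)` rooted at `W`, far cell
`(h.1 − 1, 1)`; printed weights, `θ ∈ [π/3, 2π/3]`; ONE further cell removed.

* §1 WEST wall two columns away (`h.1 = 2`): the north-western pocket `(0, 2)` ⇒ BOTH routes empty ⇒ `VF ≡ 0`
  (`thinBoxW_pocketNW_vertexFunctional_eq_zero`; contrast `lawL_box_wallPocketNW_im_neg` two rows up, where the under route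
  survives); the corner `K_N1 = (0, 3)` (`n ≥ 4`) ⇒ the over route `w₁`-killed ⇒ `VF(2π/3) = 0` EXACTLY and `Im VF > 0` on
  `[π/3, 2π/3)` (`thinBoxW_killNW_…`) — an isolated endpoint zero off the west wall, companion of the top-wall ones.
* §2 EAST wall: root plaquette two columns from it (`h.1 + 3 = m`): the corner `K_N2 = (h.1 + 2, 3)` ⇒ `VF(π/3) = 0` exactly and
  `Im VF > 0` on `(π/3, 2π/3]` (`thinBoxE_killNE_…`). (The east wall's `rootE`, `pocketSE`, `pocketNE` theorems of
  `PlaquetteWalkHoleRootEastWall` already cover `h.2 = 1`.)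
* §3 every thin box (`2 ≤ h.1 ≤ m − 3`, `n ≥ 4`): the south-western pocket `(h.1 − 2, 0)` is harmless — `VF ≠ 0` on the whole
  range (`thinBox_pocketSW_vertexFunctional_ne_zero`; both over blocks avoid it).

Not in print; venture lane «pcv-sawmu», seat b-step0 gen 27 (the lane's thin census, FINDING-YB-KILL-FORCED-ZEROS §22).

References: A. Glazman, I. Manolescu, arXiv:1708.00395v3, §1 (Fig. 2, the remark after eq. (1)), §2.1, Lemma 2.1
[GlazmanManolescu2019]; A. Glazman, Electron. Commun. Probab. 20 (2015) no. 86, Lemma 3.1, proof pp. 6–7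
[Glazman2015WeightedSAW]; R. Courant, H. Robbins, *What is Mathematics?* (1941/1958), Ch. V Appendix §2 (the even–odd rule)
[CourantRobbins1958].
-/

noncomputable section

open Set Function Complex

namespace Literature.Barriers.CriticalPhenomena.PlaquetteWalk

open Literature.Probability.RandomPlanarGeometry.SAW.YangBaxter
open Real Complex

section ThinWalls

variable {m n : ℕ} {h : Face}

/-- The `w₂`-free over block sits in any thin box minus a cell off its footprint rows `0 … 3`, columns `h.1 − 2 … h.1 + 2` —
here minus the reference cell `(ex, ey)` NOT in the block. [cite: GlazmanManolescu2019, §2.1 (finite domains of faces), §4.2 (translation invariance)] -/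
theorem overBlockW_hroot_subset_thinBox (hW : 2 ≤ h.1) (hE : h.1 + 3 ≤ m) (hS : h.2 = 1) (hN : 4 ≤ n) (ex ey : ℤ)
    (hB : ∀ a ∈ overBlockW42, a ≠ (ex, ey)) {cx cy : ℤ} (hc : cx = h.1 + ex - 3 ∧ cy = h.2 + ey - 2) :
    ∀ c ∈ overBlockW (h.1 + 1, h.2), c ∈ boxMinus m n [h, (cx, cy)] := by
  have bW : ∀ c ∈ overBlockW42, 1 ≤ c.1 ∧ c.1 ≤ 5 ∧ 1 ≤ c.2 ∧ c.2 ≤ 4 ∧ c ≠ (3, 2) := by decide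
  intro c hc'
  simp only [overBlockW, List.mem_map] at hc'
  obtain ⟨a, ha, rfl⟩ := hc'
  obtain ⟨b1, b2, b3, b4, b5⟩ := bW a ha
  have b6 := hB a ha
  obtain ⟨x, y⟩ := a
  simp only [ne_eq, Prod.mk.injEq, not_and] at b1 b2 b3 b4 b5 b6
  obtain ⟨hc1, hc2⟩ := hc
  rw [shiftBy_refShift_mk, mem_boxMinus]
  simp only [List.mem_cons, List.not_mem_nil, or_false, not_or]
  refine ⟨⟨by omega, by omega, by omega, by omega⟩, fun e => ?_, fun e => ?_⟩
  · have e' := Prod.ext_iff.1 e; simp only at e'; omega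
  · have e' := Prod.ext_iff.1 e; simp only at e'; omega

/-- The `w₁`-free over block sits in any thin box minus a cell off its footprint.
[cite: GlazmanManolescu2019, §2.1 (finite domains of faces), §4.2 (translation invariance)] -/
theorem overBlockE_hroot_subset_thinBox (hW : 2 ≤ h.1) (hE : h.1 + 3 ≤ m) (hS : h.2 = 1) (hN : 4 ≤ n) (ex ey : ℤ)
    (hB : ∀ a ∈ overBlockE42, a ≠ (ex, ey)) {cx cy : ℤ} (hc : cx = h.1 + ex - 3 ∧ cy = h.2 + ey - 2) :
    ∀ c ∈ overBlockE (h.1 + 1, h.2), c ∈ boxMinus m n [h, (cx, cy)] := by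
  have bE : ∀ c ∈ overBlockE42, 1 ≤ c.1 ∧ c.1 ≤ 5 ∧ 1 ≤ c.2 ∧ c.2 ≤ 4 ∧ c ≠ (3, 2) := by decide
  intro c hc'
  simp only [overBlockE, List.mem_map] at hc'
  obtain ⟨a, ha, rfl⟩ := hc'
  obtain ⟨b1, b2, b3, b4, b5⟩ := bE a ha
  have b6 := hB a ha
  obtain ⟨x, y⟩ := a
  simp only [ne_eq, Prod.mk.injEq, not_and] at b1 b2 b3 b4 b5 b6
  obtain ⟨hc1, hc2⟩ := hc
  rw [shiftBy_refShift_mk, mem_boxMinus]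
  simp only [List.mem_cons, List.not_mem_nil, or_false, not_or]
  refine ⟨⟨by omega, by omega, by omega, by omega⟩, fun e => ?_, fun e => ?_⟩
  · have e' := Prod.ext_iff.1 e; simp only at e'; omega
  · have e' := Prod.ext_iff.1 e; simp only at e'; omega

/-! ## §1 The west wall two columns from the hole -/

/-- ★★★★ **THIN BOX, WEST WALL TWO COLUMNS AWAY, THE NORTH-WESTERN POCKET `(0, 2)` REMOVED ⇒ `VF ≡ 0`.** The pocket on the wall
empties the over route (`ΩG.WE_eq_excursionWinding_of_over_wallPocketNW`), the thin side the under route: no wound walk at all.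
[cite: GlazmanManolescu2019, Lemma 2.1 (statement, "in the form given in [Gl]"), §2.1] [cite: Glazman2015WeightedSAW, Lemma 3.1 (proof, pp. 6–7)]
[cite: CourantRobbins1958, Ch. V Appendix §2 (the even–odd rule)] -/
theorem thinBoxW_pocketNW_vertexFunctional_eq_zero (hW : h.1 = 2) (hE : h.1 + 3 ≤ m) (hS : h.2 = 1) (hN : 3 ≤ n) {θ : ℝ}
    (hθ : θ ∈ Set.Icc (π / 3) (2 * π / 3)) :
    vertexFunctional (printedWeights θ) tFiveEighths (ybCoeff θ) (boxMinus m n [h, (0, h.2 + 1)])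
      (Face.side (h.1 + 1, h.2) .W) (farW (h.1 + 1, h.2)) = 0 := by
  obtain ⟨hf, hh, hKS, hT, hcolS⟩ := thinBox_hyps (m := m) (n := n) (S := [h, (0, h.2 + 1)]) (by omega) (by omega) hS
    (by omega) (by simp) (by
      rw [List.mem_cons, List.mem_singleton, not_or]
      exact ⟨fun e => by have := (Prod.ext_iff.1 e).1; simp only at this; omega,
        fun e => by have := (Prod.ext_iff.1 e).2; simp only at this; omega⟩)
  have hr := rootedFace_hroot_boxMinus_of_mem hf (by simp)
  refine vertexFunctional_printed_eq_zero_of_thinS_of_over_empty hθ hf hh hKS hT hcolS hr fun ω hb hNd => ?_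
  refine ΩG.WE_eq_excursionWinding_of_over_wallPocketNW hh ?_ (fun x hx => ?_) ω hr hb hNd θ
  · have e : pocketNW ((h.1 + 1, h.2) : Face) = (0, h.2 + 1) := Prod.ext (by simp only [pocketNW]; omega) (by simp only [pocketNW])
    rw [e]; exact not_mem_dom_boxMinus_of_mem (by simp)
  · left; intro hm; have hb' := (mem_dom_boxMinus.1 hm).1; simp only at hb' hx; omega

/-- ★★★★★ **THIN BOX, WEST WALL TWO COLUMNS AWAY, THE CORNER `K_N1 = (0, 3)` REMOVED ⇒ `VF(2π/3) = 0` EXACTLY** (`n ≥ 4`):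
the over route is `w₁`-killed by the north-western corridor on the wall, the under route is empty.
[cite: GlazmanManolescu2019, §1 (remark after eq. (1)), §2.1, Lemma 2.1] [cite: Glazman2015WeightedSAW, Lemma 3.1 (proof, pp. 6–7)]
[cite: CourantRobbins1958, Ch. V Appendix §2 (the even–odd rule)] -/
theorem thinBoxW_killNW_vertexFunctional_two_pi_div_three_eq_zero (hW : h.1 = 2) (hE : h.1 + 3 ≤ m) (hS : h.2 = 1)
    (hN : 4 ≤ n) :
    vertexFunctional (printedWeights (2 * π / 3)) tFiveEighths (ybCoeff (2 * π / 3))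
      (boxMinus m n [h, killNW (h.1 + 1, h.2)]) (Face.side (h.1 + 1, h.2) .W) (farW (h.1 + 1, h.2)) = 0 := by
  obtain ⟨hf, hh, hKS, hT, hcolS⟩ := thinBox_hyps (m := m) (n := n) (S := [h, killNW (h.1 + 1, h.2)]) (by omega) (by omega) hS
    (by omega) (by simp) (by
      rw [List.mem_cons, List.mem_singleton, not_or]
      exact ⟨fun e => by have := (Prod.ext_iff.1 e).1; simp only at this; omega,
        fun e => by have := (Prod.ext_iff.1 e).2; simp only [killNW] at this; omega⟩)
  have hr := rootedFace_hroot_boxMinus_of_mem hf (by simp)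
  refine vertexFunctional_printed_two_pi_div_three_eq_zero_of_thinS_of_over_w1_killed hf hh hKS hT hcolS hr ?_
  refine ΩG.over_killed_of_killNW_corridor hh (not_mem_dom_boxMinus_of_mem (by simp))
    (isCorridorNW_boxMinus (Or.inl hW) (by simp)) (fun y hy => ?_) hr _
  simp only at hy ⊢
  by_cases hD : ((h.1 + 1 - 3, y) : Face) ∈ dom (boxMinus m n [h, killNW (h.1 + 1, h.2)])
  · right; right; simp only [Set.mem_setOf_eq]; exact ⟨hD, by omega, by omega⟩
  · exact Or.inl hD

/-- … and `Im VF(θ) > 0` for every `θ ∈ [π/3, 2π/3)` (the `w₂`-free over block survives).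
[cite: GlazmanManolescu2019, §1 (Fig. 2), §2.1, Lemma 2.1] [cite: Glazman2015WeightedSAW, Lemma 3.1 (proof, pp. 6–7)] -/
theorem thinBoxW_killNW_im_pos_of_lt (hW : h.1 = 2) (hE : h.1 + 3 ≤ m) (hS : h.2 = 1) (hN : 4 ≤ n) {θ : ℝ}
    (hθ : θ ∈ Set.Ico (π / 3) (2 * π / 3)) :
    0 < (vertexFunctional (printedWeights θ) tFiveEighths (ybCoeff θ) (boxMinus m n [h, killNW (h.1 + 1, h.2)])
      (Face.side (h.1 + 1, h.2) .W) (farW (h.1 + 1, h.2))).im := by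
  obtain ⟨hf, hh, hKS, hT, hcolS⟩ := thinBox_hyps (m := m) (n := n) (S := [h, killNW (h.1 + 1, h.2)]) (by omega) (by omega) hS
    (by omega) (by simp) (by
      rw [List.mem_cons, List.mem_singleton, not_or]
      exact ⟨fun e => by have := (Prod.ext_iff.1 e).1; simp only at this; omega,
        fun e => by have := (Prod.ext_iff.1 e).2; simp only [killNW] at this; omega⟩)
  have hr := rootedFace_hroot_boxMinus_of_mem hf (by simp)
  have e : killNW ((h.1 + 1, h.2) : Face) = (h.1 - 2, h.2 + 2) :=
    Prod.ext (by simp only [killNW]; omega) (by simp only [killNW])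
  have hB : ∀ c ∈ overBlockW (h.1 + 1, h.2), c ∈ boxMinus m n [h, killNW (h.1 + 1, h.2)] := by
    rw [e]; exact overBlockW_hroot_subset_thinBox (by omega) hE hS hN 1 4 (by decide) ⟨by omega, by omega⟩
  exact im_vertexFunctional_printed_pos_of_thinS_of_w2free hθ hf hh hKS hT hcolS hr
    fun θ' => exists_over_w2free_of_overBlockW hB hr θ'

/-! ## §2 The root plaquette two columns from the east wall -/

/-- ★★★★★ **THIN BOX, ROOT PLAQUETTE TWO COLUMNS FROM THE EAST WALL, THE CORNER `K_N2 = (h.1 + 2, 3)` REMOVED ⇒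
`VF(π/3) = 0` EXACTLY** (`n ≥ 4`): the over route is `w₂`-killed by the north-eastern corridor on the wall, the under route empty.
[cite: GlazmanManolescu2019, §1 (the paragraph of Fig. 2), §2.1, Lemma 2.1] [cite: Glazman2015WeightedSAW, Lemma 3.1 (proof, pp. 6–7)]
[cite: CourantRobbins1958, Ch. V Appendix §2 (the even–odd rule)] -/
theorem thinBoxE_killNE_vertexFunctional_pi_div_three_eq_zero (hW : 2 ≤ h.1) (hE : h.1 + 3 = m) (hS : h.2 = 1)
    (hN : 4 ≤ n) :
    vertexFunctional (printedWeights (π / 3)) tFiveEighths (ybCoeff (π / 3))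
      (boxMinus m n [h, killNE (h.1 + 1, h.2)]) (Face.side (h.1 + 1, h.2) .W) (farW (h.1 + 1, h.2)) = 0 := by
  obtain ⟨hf, hh, hKS, hT, hcolS⟩ := thinBox_hyps (m := m) (n := n) (S := [h, killNE (h.1 + 1, h.2)]) hW (by omega) hS
    (by omega) (by simp) (by
      rw [List.mem_cons, List.mem_singleton, not_or]
      exact ⟨fun e => by have := (Prod.ext_iff.1 e).1; simp only at this; omega,
        fun e => by have := (Prod.ext_iff.1 e).2; simp only [killNE] at this; omega⟩)
  have hr := rootedFace_hroot_boxMinus_of_mem hf (by simp)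
  refine vertexFunctional_printed_pi_div_three_eq_zero_of_thinS_of_over_w2_killed hf hh hKS hT hcolS hr ?_
  refine ΩG.over_w2_killed_of_killNE_corridor hh (not_mem_dom_boxMinus_of_mem (by simp))
    (isCorridorN_boxMinus (Or.inl hE) (by simp)) (fun y hy => ?_) hr _
  simp only at hy ⊢
  by_cases hD : ((h.1 + 1 + 1, y) : Face) ∈ dom (boxMinus m n [h, killNE (h.1 + 1, h.2)])
  · right; right; simp only [Set.mem_setOf_eq]; exact ⟨hD, by omega, by omega⟩
  · exact Or.inr (Or.inl hD)

/-- … and `Im VF(θ) > 0` for every `θ ∈ (π/3, 2π/3]` (the `w₁`-free over block survives).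
[cite: GlazmanManolescu2019, §1 (remark after eq. (1)), §2.1, Lemma 2.1] [cite: Glazman2015WeightedSAW, Lemma 3.1 (proof, pp. 6–7)] -/
theorem thinBoxE_killNE_im_pos_of_gt (hW : 2 ≤ h.1) (hE : h.1 + 3 = m) (hS : h.2 = 1) (hN : 4 ≤ n) {θ : ℝ}
    (hθ : θ ∈ Set.Ioc (π / 3) (2 * π / 3)) :
    0 < (vertexFunctional (printedWeights θ) tFiveEighths (ybCoeff θ) (boxMinus m n [h, killNE (h.1 + 1, h.2)])
      (Face.side (h.1 + 1, h.2) .W) (farW (h.1 + 1, h.2))).im := by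
  obtain ⟨hf, hh, hKS, hT, hcolS⟩ := thinBox_hyps (m := m) (n := n) (S := [h, killNE (h.1 + 1, h.2)]) hW (by omega) hS
    (by omega) (by simp) (by
      rw [List.mem_cons, List.mem_singleton, not_or]
      exact ⟨fun e => by have := (Prod.ext_iff.1 e).1; simp only at this; omega,
        fun e => by have := (Prod.ext_iff.1 e).2; simp only [killNE] at this; omega⟩)
  have hr := rootedFace_hroot_boxMinus_of_mem hf (by simp)
  have e : killNE ((h.1 + 1, h.2) : Face) = (h.1 + 2, h.2 + 2) :=
    Prod.ext (by simp only [killNE]; omega) (by simp only [killNE])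
  have hB : ∀ c ∈ overBlockE (h.1 + 1, h.2), c ∈ boxMinus m n [h, killNE (h.1 + 1, h.2)] := by
    rw [e]; exact overBlockE_hroot_subset_thinBox hW (by omega) hS hN 5 4 (by decide) ⟨by omega, by omega⟩
  exact im_vertexFunctional_printed_pos_of_thinS_of_w1free hθ hf hh hKS hT hcolS hr
    fun θ' => exists_over_w1free_of_overBlockE hB hr θ'

/-! ## §3 The south-western pocket is harmless in every thin box -/

/-- ★★★ **THIN BOX, THE SOUTH-WESTERN POCKET `(h.1 − 2, 0)` REMOVED ⇒ `VF ≠ 0` ON THE WHOLE RANGE** (`2 ≤ h.1 ≤ m − 3`, `n ≥ 4`):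
both over blocks avoid it. [cite: GlazmanManolescu2019, Lemma 2.1 (statement, "in the form given in [Gl]"), §2.1]
[cite: Glazman2015WeightedSAW, Lemma 3.1 (proof, pp. 6–7)] -/
theorem thinBox_pocketSW_vertexFunctional_ne_zero (hW : 2 ≤ h.1) (hE : h.1 + 3 ≤ m) (hS : h.2 = 1) (hN : 4 ≤ n) {θ : ℝ}
    (hθ : θ ∈ Set.Icc (π / 3) (2 * π / 3)) :
    vertexFunctional (printedWeights θ) tFiveEighths (ybCoeff θ) (boxMinus m n [h, (h.1 - 2, 0)])
      (Face.side (h.1 + 1, h.2) .W) (farW (h.1 + 1, h.2)) ≠ 0 := by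
  obtain ⟨hf, hh, hKS, hT, hcolS⟩ := thinBox_hyps (m := m) (n := n) (S := [h, (h.1 - 2, 0)]) hW (by omega) hS
    (by omega) (by simp) (by
      rw [List.mem_cons, List.mem_singleton, not_or]
      exact ⟨fun e => by have := (Prod.ext_iff.1 e).1; simp only at this; omega,
        fun e => by have := (Prod.ext_iff.1 e).1; simp only at this; omega⟩)
  have hr := rootedFace_hroot_boxMinus_of_mem hf (by simp)
  exact vertexFunctional_printed_ne_zero_of_thinS_of_witnesses hθ hf hh hKS hT hcolS hr
    (fun θ' => exists_over_w2free_of_overBlockW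
      (overBlockW_hroot_subset_thinBox hW hE hS hN 1 1 (by decide) ⟨by omega, by omega⟩) hr θ')
    (fun θ' => exists_over_w1free_of_overBlockE
      (overBlockE_hroot_subset_thinBox hW hE hS hN 1 1 (by decide) ⟨by omega, by omega⟩) hr θ')

end ThinWalls

end Literature.Barriers.CriticalPhenomena.PlaquetteWalk
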